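import Literature.AlgebraicGeometry.AbelianSchemes.HomKillsTorsionOfThickening
import Literature.AlgebraicGeometry.AbelianSchemes.MumfordLambdaOfBaseChangeSquare
import Literature.AlgebraicGeometry.AbelianSchemes.AbelianSchemeLDeltaOfLambdaGlobal
import Literature.AlgebraicGeometry.AbelianSchemes.PolarizationLevelBaseQuotientDescent
import Literature.AlgebraicGeometry.AbelianSchemes.AbelianSchemeOverMulNSurjective
import HarnessLib

/-!
# A lift of the symmetric line bundle `L^Δ(λ₀)` along a nilpotent thickening yields a lift of the polarisation `λ₀`
# (F-11 cut α, piece α3: [Oort1971] §2.3–2.4; [MumfordFogartyKirwan1994] Ch. 6 §2 Prop. 6.10–6.11; [Lan2013PELCompactifications] §2.2.4)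

Layer `Literature/AlgebraicGeometry/AbelianSchemes`, namespace `Literature.AlgebraicGeometry.AbelianSchemes.AbelianSchemeOver`.
THEOREMS ONLY (no definition, no named fact, no instance, no notation, no `sorry`).  Cell `hodgecm-mathlib` (D-0151 / D-0183
FLOOR 0), programme P1 sub-line F-11 (`Cruxes/HDel/Lines/F11SmoothRoadA.lean`, stub `stub_polarizedLift`, v1 cut α: THIS IS
PIECE α3 `stub_homOfLineBundleLift`; B-p05 (g19)).  Count-neutral capital; HC_CM is proved only modulo the 7 printed
citations until rung 0 closes, and nothing here is about HC.

THE PRINT.  [Oort1971] §2 / [MumfordFogartyKirwan1994] App. 7A p. 235 reduce the infinitesimal lifting of a polarised abelian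
scheme `(X₀, λ₀)` to lifting the PAIR `(X₀, L^Δ(λ₀))` (an abelian scheme with a line bundle) and then recovering `λ` from the
lifted bundle: `Λ(L) : X → X̂` ([MumfordFogartyKirwan1994] Def. 6.2) restricts to `Λ(L^Δ(λ₀)) = 2λ₀` (Prop. 6.10), it kills
`X[2]` because `X[2]`, `X̂[2]` are étale and the restriction kills `X₀[2]` (Prop. 6.11's descent through `[2]`), so
`Λ(L) = 2λ` for a unique homomorphism `λ` lifting `λ₀`; ampleness on the (common) geometric fibres is that of `λ₀`
([MumfordFogartyKirwan1994] Def. 6.3).  Here in the RELATION form of the tree (★ `IsBaseChangeVia`): a base-change square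
`G : A₀ → X` over a surjective closed immersion `i : S₀ → S` (both bases connected, locally Noetherian, `2` invertible),
dual pairs `D₀`, `D` normalised on `X × {ε̂}` with a base-change square `Ĝ` and the Poincaré clause `(G × Ĝ)^*𝒫 ≅ 𝒫₀`,
a polarisation `λ₀` of `A₀`, and a rigidified line bundle `L` on `X` with `G^*L ≅ L^Δ(λ₀) = (1, λ₀)^*𝒫₀`.

* `exists_polarization_of_lineBundle_lift` — THE α3 PIECE: there is a polarisation `pol` of `X` w.r.t. `D` with the
  `λ`-clause `λ₀ ≫ Ĝ = G ≫ pol.lam` of ★ `PolarizedAbelianSchemeWithLevel.IsBaseChangeVia`.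
  Assembly: `Λ(L)`, `Λ(G^*L)` (★ `exists_isMonHom_classify_mumfordBundle`); `Λ(G^*L) ≫ Ĝ = G ≫ Λ(L)` (★-in-HOME
  `IsBaseChangeVia.classifyMumford_left_comp_eq`); `Λ(L^Δ(λ₀)) = λ₀·λ₀` (★ `eq_mul_self_of_classify_mumfordBundle_LDelta`);
  division `Λ(L) = [2] ≫ λ` (★-in-HOME `exists_isMonHom_pow_id_comp_eq_of_isBaseChangeVia_of_surjective`); the `λ`-clause
  by cancelling the epimorphism `[2]_{A₀}`; ampleness at geometric points (all of which factor through `i`) by ★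
  `transfer_of_isBaseChangeVia_fibreIso`.

## References
* [Oort1971] F. Oort, *Finite group schemes, local moduli for abelian varieties, and lifting problems*, Compos. Math. 23
  (1971), §2.3–2.4.
* [MumfordFogartyKirwan1994] D. Mumford, J. Fogarty, F. Kirwan, *Geometric Invariant Theory*, 3rd ed. (1994), Ch. 6 §2
  Def. 6.2–6.3 (p. 120), Prop. 6.10 (p. 121), Prop. 6.11 (p. 122); App. 7A (pp. 234–235).
* [Lan2013PELCompactifications] K.-W. Lan, *Arithmetic compactifications of PEL-type Shimura varieties* (2013), §2.2.4
  Cor. 2.2.4.12–2.2.4.14 (p. 150).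
* [MumfordAV1970] D. Mumford, *Abelian Varieties* (1970), §7 Thm. 4 (p. 72), §8 (pp. 74–75).
-/

set_option backward.isDefEq.respectTransparency false

noncomputable section

open CategoryTheory CategoryTheory.Limits AlgebraicGeometry MonoidalCategory CartesianMonoidalCategory
open scoped MonObj

universe u

namespace Literature.AlgebraicGeometry.AbelianSchemes

open Literature.AlgebraicGeometry.Motives Literature.AlgebraicGeometry.Modules
  Literature.AlgebraicGeometry.AbelianVarieties

namespace AbelianSchemeOver

variable {S₀ S : Scheme.{u}} {i : S₀ ⟶ S} [IsClosedImmersion i] [Surjective i]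
  [IsLocallyNoetherian S] [PreconnectedSpace S] [IsLocallyNoetherian S₀] [PreconnectedSpace S₀] [Nonempty S₀]
  {A₀ : AbelianSchemeOver S₀} (X : AbelianSchemeOver S) {G : A₀.X.left ⟶ X.X.left}

/-- Property (ii) of ★ `exists_isMonHom_classify_mumfordBundle` is insensitive to replacing `L` by an isomorphic line bundle
(checked on determinant classes: `[Λ(L)] = Λ([L]) = Λ([L′]) = [Λ(L′)]`). [cite: MumfordFogartyKirwan1994, Ch. 6 §2 Definition 6.2 (p. 120)] -/
private theorem classifyMumford_congr_of_iso {T₀ : Scheme.{u}} (B : AbelianSchemeOver T₀) (E : B.DualPair)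
    {M M' : B.left.Modules} (hM : HasRank M 1) (hM' : HasRank M' 1) (e : M ≅ M') (mu : B.X ⟶ E.hat.X)
    (hmu : ∀ {T : Over T₀} (u : T ⟶ B.X), Nonempty (E.pullbackP T.hom (u ≫ mu).left (Over.w _) ≅
      (Scheme.Modules.pullback (B.X ◁ u).left).obj (B.mumfordBundle M)))
    {T : Over T₀} (u : T ⟶ B.X) :
    Nonempty (E.pullbackP T.hom (u ≫ mu).left (Over.w _) ≅
      (Scheme.Modules.pullback (B.X ◁ u).left).obj (B.mumfordBundle M')) := by
  obtain ⟨j⟩ := hmu u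
  have hΛ := B.hasRank_mumfordBundle hM
  have hΛ' := B.hasRank_mumfordBundle hM'
  have hΛ₁ := HasRank.isFiniteLocallyFree' hΛ
  have hΛ'₁ := HasRank.isFiniteLocallyFree' hΛ'
  have hc : detClass (HasRank.isFiniteLocallyFree' hM) = detClass (HasRank.isFiniteLocallyFree' hM') :=
    detClass_eq_of_iso e _ _
  have k : Nonempty ((Scheme.Modules.pullback (B.X ◁ u).left).obj (B.mumfordBundle M) ≅
      (Scheme.Modules.pullback (B.X ◁ u).left).obj (B.mumfordBundle M')) := by
    refine (nonempty_iso_iff_detClass_eq (hasRank_pullback _ hΛ) (hasRank_pullback _ hΛ') (hΛ₁.pullback _)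
      (hΛ'₁.pullback _)).2 ?_
    rw [detClass_pullback _ hΛ₁, detClass_pullback _ hΛ'₁, B.detClass_mumfordBundle hM hΛ₁,
      B.detClass_mumfordBundle hM' hΛ'₁, hc]
  obtain ⟨k⟩ := k
  exact ⟨j ≪≫ k⟩

/-- **F-11 cut α, piece α3: a lift of `L^Δ(λ₀)` gives a lift of the polarisation `λ₀`.**  Let `i : S₀ → S` be a surjective
closed immersion of connected locally Noetherian schemes on which `2` is invertible, `G : A₀ → X` over `i` a base-change square
of abelian schemes (★ `IsBaseChangeVia`), `D₀ = (Â₀, 𝒫₀)`, `D = (X̂, 𝒫)` dual pairs normalised on the `{ε̂}`-slices, `Ĝ : Â₀ → X̂`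
a base-change square over `i` with the Poincaré clause `(G × Ĝ)^*𝒫 ≅ 𝒫₀`, `λ₀` a polarisation of `A₀` w.r.t. `D₀` with graph
`Gr₀ = (1, λ₀)`, and `L` a rank-one module on `X` rigidified along `ε_X` with `G^*L ≅ L^Δ(λ₀) = Gr₀^*𝒫₀`.  Then there is a
polarisation `pol` of `X` w.r.t. `D` with `λ₀ ≫ Ĝ = G ≫ pol.lam` — the `λ`-clause of the pull-back relation of triples.
(`Λ(L) = [2] ≫ pol.lam`; [MumfordFogartyKirwan1994] Prop. 6.10 + the descent through `[2]` of Prop. 6.11 along the thickening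
+ Def. 6.3 on the geometric fibres.) [cite: MumfordFogartyKirwan1994, Ch. 6 §2 Proposition 6.10 (p. 121) and Prop. 6.11 (p. 122)]
[cite: MumfordFogartyKirwan1994, Ch. 6 §2 Definition 6.3 (p. 120)] [cite: MumfordAV1970, §7 Thm. 4 (p. 72)] -/
theorem exists_polarization_of_lineBundle_lift (h2 : ∀ s : S, (2 : S.residueField s) ≠ 0)
    (h2₀ : ∀ s : S₀, (2 : S₀.residueField s) ≠ 0) (hG : A₀.IsBaseChangeVia X i G)
    (D₀ : A₀.DualPair)
    (hD₀ : Nonempty ((Scheme.Modules.pullback (DualPair.unitHatSlice D₀)).obj D₀.P ≅ SheafOfModules.unit _))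
    (D : X.DualPair) (hD : Nonempty ((Scheme.Modules.pullback (DualPair.unitHatSlice D)).obj D.P ≅ SheafOfModules.unit _))
    {Ĝ : D₀.hat.X.left ⟶ D.hat.X.left} (hĜ : D₀.hat.IsBaseChangeVia D.hat i Ĝ)
    (hP : Nonempty ((Scheme.Modules.pullback
      (pullback.map A₀.X.hom D₀.hat.X.hom X.X.hom D.hat.X.hom G Ĝ i hG.fst.symm hĜ.fst.symm)).obj D.P ≅ D₀.P))
    (pol₀ : A₀.Polarization D₀) (Gr₀ : A₀.X.left ⟶ A₀.prodLeft D₀.hat)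
    (hGr₁ : Gr₀ ≫ pullback.fst A₀.X.hom D₀.hat.X.hom = 𝟙 _) (hGr₂ : Gr₀ ≫ pullback.snd A₀.X.hom D₀.hat.X.hom = pol₀.lam.left)
    {L : X.left.Modules} (hL : HasRank L 1)
    (hε : CechPic.pullback X.unitSection (detClass (HasRank.isFiniteLocallyFree' hL)) = 1)
    (hLΔ : Nonempty ((Scheme.Modules.pullback G).obj L ≅ (Scheme.Modules.pullback Gr₀).obj D₀.P)) :
    ∃ pol : X.Polarization D, pol₀.lam.left ≫ Ĝ = G ≫ pol.lam.left := by
  haveI : IsCommMonObj X.X := X.isCommMonObj_of_isLocallyNoetherian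
  haveI := pol₀.isMonHom
  -- ranks, classes, rigidifications
  have hL₁ := HasRank.isFiniteLocallyFree' hL
  set L₀ : A₀.left.Modules := (Scheme.Modules.pullback G).obj L with hL₀def
  have hL₀ : HasRank L₀ 1 := hasRank_pullback _ hL
  have hL₀₁ := HasRank.isFiniteLocallyFree' hL₀
  have hc₀ : detClass hL₀₁ = CechPic.pullback G (detClass hL₁) := by rw [← detClass_pullback G hL₁]
  have hε₀ : CechPic.pullback A₀.unitSection (detClass hL₀₁) = 1 := by
    rw [hc₀]; exact hG.pullback_unitSection_pullback_eq_one _ hε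
  set LΔ : A₀.left.Modules := (Scheme.Modules.pullback Gr₀).obj D₀.P with hLΔdef
  have hLΔr : HasRank LΔ 1 := hasRank_pullback _ D₀.hasRank_one
  obtain ⟨eΔ⟩ := hLΔ
  have hcΔ : detClass (HasRank.isFiniteLocallyFree' hLΔr) = detClass hL₀₁ := (detClass_eq_of_iso eΔ hL₀₁ _).symm
  have hεΔ : CechPic.pullback A₀.unitSection (detClass (HasRank.isFiniteLocallyFree' hLΔr)) = 1 := by
    rw [hcΔ]; exact hε₀
  -- `Λ(L)` over `S`, `Λ(G^*L)` over `S₀`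
  obtain ⟨lamL, hmon, hii, -⟩ := X.exists_isMonHom_classify_mumfordBundle D hD hL hε
  obtain ⟨lamL₀, hmon₀, hii₀, -⟩ := A₀.exists_isMonHom_classify_mumfordBundle D₀ hD₀ hL₀ hε₀
  haveI := hmon
  haveI := hmon₀
  -- naturality: `Λ(G^*L) ≫ Ĝ = G ≫ Λ(L)`
  have hnat : lamL₀.left ≫ Ĝ = G ≫ lamL.left :=
    hG.classifyMumford_left_comp_eq D D₀ hĜ hP hL hε lamL hii lamL₀ hii₀
  -- Prop. 6.10: `Λ(G^*L) = Λ(L^Δ(λ₀)) = λ₀·λ₀`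
  have hiiΔ : ∀ ⦃T : Over S₀⦄ (u : T ⟶ A₀.X), Nonempty (D₀.pullbackP T.hom (u ≫ lamL₀).left (Over.w _) ≅
      (Scheme.Modules.pullback (A₀.X ◁ u).left).obj (A₀.mumfordBundle LΔ)) := fun T u =>
    A₀.classifyMumford_congr_of_iso D₀ hL₀ hLΔr eΔ lamL₀ hii₀ u
  have h610 : lamL₀ = pol₀.lam * pol₀.lam :=
    A₀.eq_mul_self_of_classify_mumfordBundle_LDelta D₀ pol₀ Gr₀ hGr₁ hGr₂ hεΔ lamL₀ hiiΔ
  -- `Λ(L)` kills the `2`-torsion: tested over `S₀`, where it is `λ₀·λ₀`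
  have h₀ : ∀ ⦃T₀ : Over S₀⦄ (t₀ : T₀ ⟶ A₀.X), t₀ ^ 2 = 1 → hG.pushHom t₀ ≫ lamL = 1 := by
    intro T₀ t₀ ht₀
    have hkill : t₀ ≫ (pol₀.lam * pol₀.lam) = 1 := by
      rw [MonObj.comp_mul, ← MonObj.mul_comp, ← pow_two, ht₀, MonObj.one_comp]
    have hkillL := (A₀.comp_eq_one_iff_left t₀ (pol₀.lam * pol₀.lam)).1 hkill
    rw [X.comp_eq_one_iff_left]
    change (t₀.left ≫ G) ≫ lamL.left = (T₀.hom ≫ i) ≫ D.hat.unitSection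
    rw [Category.assoc, ← hnat, h610, ← Category.assoc, hkillL, Category.assoc, Category.assoc]
    congr 1
    exact hĜ.snd.2.1
  -- division by `[2]`
  obtain ⟨lam, hlamMon, hdiv, -⟩ :=
    X.exists_isMonHom_pow_id_comp_eq_of_isBaseChangeVia_of_surjective lamL h2 hG h₀
  haveI := hlamMon
  -- the `λ`-clause: cancel the epimorphism `[2]_{A₀}`
  have hclause : pol₀.lam.left ≫ Ĝ = G ≫ lam.left := by
    haveI := A₀.flat_pow_id_left h2₀
    haveI := A₀.surjective_pow_id_left h2₀
    haveI : QuasiCompact ((((𝟙 A₀.X : A₀.X ⟶ A₀.X) ^ 2) : A₀.X ⟶ A₀.X).left) := by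
      haveI := A₀.isProper_pow_id_left 2
      infer_instance
    rw [← cancel_epi ((((𝟙 A₀.X : A₀.X ⟶ A₀.X) ^ 2) : A₀.X ⟶ A₀.X).left)]
    have hsq : ((𝟙 A₀.X : A₀.X ⟶ A₀.X) ^ 2) ≫ pol₀.lam = pol₀.lam * pol₀.lam := by
      rw [MonObj.pow_comp, Category.id_comp, pow_two]
    calc ((((𝟙 A₀.X : A₀.X ⟶ A₀.X) ^ 2) : A₀.X ⟶ A₀.X).left) ≫ pol₀.lam.left ≫ Ĝ
        = (pol₀.lam * pol₀.lam).left ≫ Ĝ := by rw [← Category.assoc, ← Over.comp_left, hsq]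
      _ = G ≫ lamL.left := by rw [← h610, hnat]
      _ = G ≫ ((((𝟙 X.X : X.X ⟶ X.X) ^ 2) : X.X ⟶ X.X).left) ≫ lam.left := by rw [← Over.comp_left, hdiv]
      _ = ((((𝟙 A₀.X : A₀.X ⟶ A₀.X) ^ 2) : A₀.X ⟶ A₀.X).left) ≫ G ≫ lam.left := by
          rw [← Category.assoc, ← hG.pow_id_left_comp, Category.assoc]
  -- ampleness at the geometric points of `S` (which factor through `i`)
  obtain ⟨eP⟩ := hP
  refine ⟨⟨lam, hlamMon, fun Ω _ _ s => ?_⟩, hclause⟩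
  obtain ⟨s₀, hs₀⟩ := exists_comp_eq_of_isClosedImmersion_of_surjective i s
  subst hs₀
  obtain ⟨e, he⟩ := hG.exists_fibreIso s₀
  obtain ⟨Θ₀, hΘ₀, hl₀⟩ := pol₀.exists_ample Ω s₀
  haveI : IsDominant (AbelianVariety.Hom.toSchemeHom e.inv) := AbelianVariety.isDominant_toSchemeHom_iso_hom e.symm
  exact ⟨_, transfer_of_isBaseChangeVia_fibreIso X D lam A₀ D₀ pol₀.lam i G Ĝ hG.fst.symm hĜ.fst.symm hclause s₀ e he
    eP Θ₀ hΘ₀ hl₀⟩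

end AbelianSchemeOver

end Literature.AlgebraicGeometry.AbelianSchemes

end
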